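import Literature.AlgebraicGeometry.Resolution.MonomializationAlongValuation
import Literature.AlgebraicGeometry.Resolution.MarkedIdealsLemmas
import HarnessLib

/-!
# The preimage of a hypersurface `V(a) ⊂ Spec A` under `σ : X → Spec A`: stalk lemmas at a prescribed point

Route `RadicialJung`, crux `CleanModels` (stmt-ResolutionOfSingularities-15917), registered skeleton `Cruxes/CleanModels/Lines/Sketch.lean`
rev 35 (sha16 de44649d8f729c3b), stub 7 `stub_cleanModelsDimGEFour`.  Explicit-unit seat `decomp-res-hand-2` g6 (structural hand): bricks of
the residue-side DRIVER `CossartJannsenSaito2020Embedded → ResidueChains` (spec `Lines/Sketch_hand2_g5_NS32_assembly_spec.lean` rev 4), the one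
remaining non-kernel input of ✓ `localMonomialization_four_of_rankOne_of_residueChains`.  OURS; structural bookkeeping, counted 0; nothing
here proves resolution of singularities in characteristic `p`.

Folklore bookkeeping for a morphism `σ : X → Spec A` and an element `a ∈ A`
(the pulled-back function `σ^* a`, its germs, and the closed set `σ⁻¹(V(a))`), used to read a sequence of blow-ups in regular centres
lying over `V(a)` (Cossart–Jannsen–Saito 2020, Thm. 1.4 / Cor. 1.5, the tree's `IsEmbeddedTransform` / `CossartJannsenSaito2020Embedded`)
at the points of a valuation:

* `germ_appTop_mem_radical_stalkIdeal` — **a centre lying over `V(a)` contains `σ^* a` in the radical of its stalks**: if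
  `σ(V(C)) ⊆ V(a)` then at every point `x` the germ of `σ^* a` lies in `√(C_x)` (global Nullstellensatz for ideal sheaves, Mathlib's
  `vanishingIdeal_support`, localised);
* `exists_germ_eq_isUnit_mul_prod_pow_of_isStrictNormalCrossingsDivisor` — **monomial form at a PRESCRIBED point of an snc preimage**: if
  `σ⁻¹(V(a))` is a strict normal crossings divisor on `X` and `x ∈ σ⁻¹(V(a))` with the germ of `σ^* a` non-zero, then `𝒪_{X,x}` is regular
  with a regular system of parameters `(x₁,…,x_r; y₁,…,y_e)` in which `σ^* a = u · ∏ xᵢ^{αᵢ}`, `u` a unit (the local step of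
  `exists_fg_regular_monomial_of_isStrictNormalCrossingsDivisor_preimage`, `MonomializationAlongValuation.lean`, without the valuative
  criterion and without the passage to a finitely generated model).

HONEST FRAMING: folklore; nothing of [CossartJannsenSaito2020] is proved here.

## Sources

* The Stacks Project, Tag 01IN (support and vanishing ideal sheaf), Tag 0BI9 / de Jong 1996, 2.4 (strict normal crossings). [StacksProject]
* V. Cossart, O. Piltant, J. Algebra 320 (2008), Prop. 4.1 (monomial form from an snc support). [CossartPiltant2008]
-/

noncomputable section

set_option linter.dupNamespace false -- mandated namespace of this single-conjunct summit

open CategoryTheory CategoryTheory.Limits AlgebraicGeometry TopologicalSpace IsLocalRing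
open Literature.AlgebraicGeometry.Resolution

namespace Summit.ResolutionOfSingularities.ResolutionOfSingularities.Theorems.RadicialJung.CleanModels

universe u

open Scheme.IdealSheafData

variable {A : Type u} [CommRing A] {X : Scheme.{u}} (σ : X ⟶ Spec (.of A)) (a : A)

/-- The support of the pulled-back ideal sheaf `(a) · 𝒪_X` is `σ⁻¹(V(a))`. [folklore] -/
theorem coe_support_comap_ofIdealTop_span_singleton :
    ((((ofIdealTop (Ideal.span {(Scheme.ΓSpecIso (.of A)).inv a})).comap σ).support : Closeds X) : Set X) =
      σ.base ⁻¹' {p : Spec (.of A) | a ∈ (p : PrimeSpectrum A).asIdeal} := by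
  rw [support_comap, TopologicalSpace.Closeds.coe_preimage, coe_support_ofIdealTop,
    Scheme.zeroLocus_span, ← Set.image_singleton, Spec_zeroLocus_eq_zeroLocus]
  congr 1
  ext p
  rw [PrimeSpectrum.mem_zeroLocus, Set.singleton_subset_iff]
  rfl

/-- On an affine open `V`, the pulled-back ideal sheaf `(a) · 𝒪_X` is generated by `σ^* a|_V`. [folklore] -/
theorem ideal_comap_ofIdealTop_span_singleton (V : X.affineOpens) :
    ((ofIdealTop (Ideal.span {(Scheme.ΓSpecIso (.of A)).inv a})).comap σ).ideal V =
      Ideal.span {(σ.appLE ⊤ V le_top).hom ((Scheme.ΓSpecIso (.of A)).inv a)} := by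
  have hVle : (V : X.Opens) ≤ σ ⁻¹ᵁ ((⟨⊤, isAffineOpen_top _⟩ : (Spec (.of A)).affineOpens) :
      (Spec (.of A)).Opens) := fun _ _ => trivial
  rw [ideal_comap_eq_map_of_le σ _ ⟨⊤, isAffineOpen_top _⟩ V hVle,
    Scheme.IdealSheafData.ofIdealTop_ideal, Ideal.map_map, Ideal.map_span, Set.image_singleton]
  congr 1

/-- The germ at `x ∈ V` of `σ^* a|_V` is the germ of `σ^* a`. [folklore] -/
theorem germ_appLE_top_eq_germ_appTop (V : X.Opens) {x : X} (hxV : x ∈ V) (t : Γ(Spec (.of A), ⊤)) :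
    X.presheaf.germ V x hxV ((σ.appLE ⊤ V le_top).hom t) = X.presheaf.germ ⊤ x trivial (σ.appTop t) := by
  rw [Scheme.Hom.appLE]
  change X.presheaf.germ V x hxV (X.presheaf.map (homOfLE le_top).op (σ.app ⊤ t)) = _
  rw [TopCat.Presheaf.germ_res_apply]
  rfl

/-- **A centre lying over `V(a)` contains `σ^* a` in the radical of its stalks.** If `σ(V(C)) ⊆ V(a)` for an ideal sheaf `C` on `X`,
then at every point `x` the germ of `σ^* a` lies in `√(C_x)` (trivially off `V(C)`): `V(C) ⊆ σ⁻¹(V(a)) = V((a)·𝒪_X)`, so `(a)·𝒪_X ≤ √C` by the global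
Nullstellensatz (`vanishingIdeal_support`), and radicals localise. [folklore] -/
theorem germ_appTop_mem_radical_stalkIdeal (C : X.IdealSheafData)
    (hT : σ.base '' (C.support : Set X) ⊆ {p : Spec (.of A) | a ∈ (p : PrimeSpectrum A).asIdeal})
    (x : X) :
    X.presheaf.germ ⊤ x trivial (σ.appTop ((Scheme.ΓSpecIso (.of A)).inv a)) ∈ (stalkIdeal C x).radical := by
  classical
  set J : X.IdealSheafData := (ofIdealTop (Ideal.span {(Scheme.ΓSpecIso (.of A)).inv a})).comap σ with hJdef
  -- `V(C) ⊆ V(J)`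
  have hCJ : C.support ≤ J.support := by
    intro y hy
    change y ∈ (J.support : Set X)
    rw [hJdef, coe_support_comap_ofIdealTop_span_singleton]
    exact hT ⟨y, hy, rfl⟩
  -- hence `J ≤ √C`
  have hJC : J ≤ C.radical := by
    rw [← vanishingIdeal_support]
    exact le_support_iff_le_vanishingIdeal.mp hCJ
  -- an affine neighbourhood of `x`
  obtain ⟨_, ⟨V, hV, rfl⟩, hxV, -⟩ :=
    X.isBasis_affineOpens.exists_subset_of_mem_open (Set.mem_univ x) isOpen_univ
  -- the germ lies in `J_x`
  have h1 : X.presheaf.germ ⊤ x trivial (σ.appTop ((Scheme.ΓSpecIso (.of A)).inv a)) ∈ stalkIdeal J x := by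
    rw [stalkIdeal_eq_map_germ J ⟨V, hV⟩ hxV, hJdef, ideal_comap_ofIdealTop_span_singleton σ a ⟨V, hV⟩,
      Ideal.map_span, Set.image_singleton, ← germ_appLE_top_eq_germ_appTop σ V hxV]
    exact Ideal.mem_span_singleton_self _
  -- `J_x ≤ (√C)_x = √(C_x)`
  have h2 : stalkIdeal J x ≤ stalkIdeal C.radical x := stalkIdeal_mono hJC x
  have h3 : stalkIdeal C.radical x = (stalkIdeal C x).radical := by
    rw [stalkIdeal_eq_map_germ _ ⟨V, hV⟩ hxV, stalkIdeal_eq_map_germ _ ⟨V, hV⟩ hxV,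
      Scheme.IdealSheafData.radical_ideal]
    letI algx := X.presheaf.algebra_section_stalk (⟨x, hxV⟩ : V)
    haveI hlocx := hV.isLocalization_stalk ⟨x, hxV⟩
    change ((C.ideal ⟨V, hV⟩).radical).map (algebraMap Γ(X, V) (X.presheaf.stalk x)) =
      ((C.ideal ⟨V, hV⟩).map (algebraMap Γ(X, V) (X.presheaf.stalk x))).radical
    exact IsLocalization.map_radical (hV.primeIdealOf ⟨x, hxV⟩).asIdeal.primeCompl (X.presheaf.stalk x) _
  exact h3 ▸ h2 h1

/-- If moreover `C_x` is a radical ideal (e.g. prime: `V(C)` regular at `x`), the germ of `σ^* a` lies in `C_x` itself. [folklore] -/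
theorem germ_appTop_mem_stalkIdeal_of_isRadical (C : X.IdealSheafData)
    (hT : σ.base '' (C.support : Set X) ⊆ {p : Spec (.of A) | a ∈ (p : PrimeSpectrum A).asIdeal})
    {x : X} (hrad : (stalkIdeal C x).IsRadical) :
    X.presheaf.germ ⊤ x trivial (σ.appTop ((Scheme.ΓSpecIso (.of A)).inv a)) ∈ stalkIdeal C x :=
  hrad (germ_appTop_mem_radical_stalkIdeal σ a C hT x)

/-- **Monomial form of `σ^* a` at a PRESCRIBED point of a strict normal crossings preimage.** If `σ⁻¹(V(a))` is a strict normal crossings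
divisor on `X`, `x ∈ σ⁻¹(V(a))`, and the germ of `σ^* a` at `x` is non-zero, then `𝒪_{X,x}` is a regular local ring with a regular system
of parameters `(x₁, …, x_r; y₁, …, y_e)` (`r + e = dim`, `σ⁻¹(V(a))` cut out by `x₁ ⋯ x_r` at `x`) and `σ^* a = u · ∏ xᵢ^{αᵢ}` with `u` a
unit: the ideal of the reduced preimage is `√(σ^* a)`, equal to `(x₁ ⋯ x_r)` at `x`, and `exists_isUnit_mul_prod_pow_of_prod_mem_radical`
applies. [cite: CossartPiltant2008, Prop. 4.1] -/
theorem exists_germ_eq_isUnit_mul_prod_pow_of_isStrictNormalCrossingsDivisor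
    (hsnc : IsStrictNormalCrossingsDivisor X
      (σ.base ⁻¹' {p : Spec (.of A) | a ∈ (p : PrimeSpectrum A).asIdeal}))
    {x : X} (hx : x ∈ σ.base ⁻¹' {p : Spec (.of A) | a ∈ (p : PrimeSpectrum A).asIdeal})
    (ha0 : X.presheaf.germ ⊤ x trivial (σ.appTop ((Scheme.ΓSpecIso (.of A)).inv a)) ≠ 0) :
    ∃ (r e : ℕ) (xs : Fin r → X.presheaf.stalk x) (ys : Fin e → X.presheaf.stalk x)
      (u : X.presheaf.stalk x) (α : Fin r → ℕ),
      IsRegularLocalRing (X.presheaf.stalk x) ∧ 1 ≤ r ∧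
      ringKrullDim (X.presheaf.stalk x) = (r + e : ℕ) ∧
      Ideal.span (Set.range xs ∪ Set.range ys) = maximalIdeal (X.presheaf.stalk x) ∧ IsUnit u ∧
      X.presheaf.germ ⊤ x trivial (σ.appTop ((Scheme.ΓSpecIso (.of A)).inv a)) = u * ∏ i, xs i ^ α i := by
  classical
  obtain ⟨hregx, r, e, xs, ys, hr, hdim, hspan, hvan⟩ := hsnc.2 _ hx
  haveI := hregx
  -- an affine neighbourhood of `x`
  obtain ⟨_, ⟨V, hV, rfl⟩, hxV, -⟩ :=
    X.isBasis_affineOpens.exists_subset_of_mem_open (Set.mem_univ x) isOpen_univ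
  set J : X.IdealSheafData := (ofIdealTop (Ideal.span {(Scheme.ΓSpecIso (.of A)).inv a})).comap σ with hJdef
  have hsuppEq : J.support = ⟨closure (σ.base ⁻¹' {p : Spec (.of A) |
      a ∈ (p : PrimeSpectrum A).asIdeal}), isClosed_closure⟩ := by
    ext1
    rw [hJdef, coe_support_comap_ofIdealTop_span_singleton]
    exact (hsnc.1.closure_eq).symm
  -- the ideal of the reduced preimage on `V` is `√(σ^* a)`
  have hvanV : (vanishingIdeal ⟨closure (σ.base ⁻¹' {p : Spec (.of A) |
      a ∈ (p : PrimeSpectrum A).asIdeal}), isClosed_closure⟩).ideal ⟨V, hV⟩ =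
      (Ideal.span {(σ.appLE ⊤ V le_top).hom ((Scheme.ΓSpecIso (.of A)).inv a)}).radical := by
    rw [← hsuppEq, vanishingIdeal_support, Scheme.IdealSheafData.radical_ideal, hJdef,
      ideal_comap_ofIdealTop_span_singleton σ a ⟨V, hV⟩]
  -- in the stalk: `√(σ^* a) = (∏ xᵢ)`
  letI algx := X.presheaf.algebra_section_stalk (⟨x, hxV⟩ : V)
  haveI hlocx := hV.isLocalization_stalk ⟨x, hxV⟩
  set g := X.presheaf.germ ⊤ x trivial (σ.appTop ((Scheme.ΓSpecIso (.of A)).inv a)) with hgdef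
  have hradstalk : (Ideal.span {g}).radical = Ideal.span {∏ i, xs i} := by
    have h1 := hvan ⟨V, hV⟩ hxV
    rw [hvanV] at h1
    rw [← h1]
    change _ = ((Ideal.span {(σ.appLE ⊤ V le_top).hom ((Scheme.ΓSpecIso (.of A)).inv a)}).radical).map
      (algebraMap Γ(X, V) (X.presheaf.stalk x))
    rw [IsLocalization.map_radical (hV.primeIdealOf ⟨x, hxV⟩).asIdeal.primeCompl (X.presheaf.stalk x),
      Ideal.map_span, Set.image_singleton]
    congr 2
    rw [hgdef, ← germ_appLE_top_eq_germ_appTop σ V hxV]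
    rfl
  have hrad : ∏ i, xs i ∈ (Ideal.span {g}).radical := by
    rw [hradstalk]
    exact Ideal.mem_span_singleton_self _
  obtain ⟨u, α, hu, hfact⟩ := exists_isUnit_mul_prod_pow_of_prod_mem_radical xs ys hdim hspan g ha0 hrad
  exact ⟨r, e, xs, ys, u, α, hregx, hr, hdim, hspan, hu, hfact⟩

end Summit.ResolutionOfSingularities.ResolutionOfSingularities.Theorems.RadicialJung.CleanModels

end
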